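import Mathlib

/-!
# The conductor exponent `n(ψ)` of an additive character of a local field

Tier-5 support for the (A6) step of §N5.12.6 / §N5.13.2 (route/T5-route-2.md l. 599 «ONE LINE»)
and for the «stays prose» column of `T5TraceDualConductor` (p394400): the definition of the
conductor exponent `n(ψ)` of a non-trivial additive character `ψ` of a local field `F` — the
largest `n` such that `ψ` is trivial on `P_F^{-n}` — and the dictionary
«`ψ` trivial on `P_F^{-k}` ⟺ `k ≤ n(ψ)` ⟺ `P_F^{-k} ⊆ P_F^{-n(ψ)}`».

Setting: `K` a field, `v : Valuation K ℤᵐ⁰`, `ψ : AddChar K M` an additive character with values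
in a monoid `M` (`ℂ^×`).  The fractional ideal `P^{-k}` is the ball
`v.leAddSubgroup (exp k) = {x ∣ v x ≤ exp k}` (Mathlib's `Valuation.leAddSubgroup`); «`ψ` is
trivial on `P^{-k}`» is written out as `∀ x, v x ≤ exp k → ψ x = 1`.  The conductor exponent is
`conductorExp ψ v := sSup {k ∣ ∀ x, v x ≤ exp k → ψ x = 1}`; it is well defined as soon as `ψ`
is trivial on SOME ball (continuity of `ψ`, a hypothesis here) and non-trivial somewhere.  No
topology is used: the two hypotheses are the only inputs.

Uses an L-value-free non-vanishing device: NO.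
-/

namespace Summit.Ventures.HodgeRepro2.T5AdditiveConductor

open WithZero

variable {K M : Type*} [Field K] [Monoid M]

/-- The conductor exponent `n(ψ)`: the largest `k` such that `ψ` is trivial on the ball
`P^{-k} = {x ∣ v x ≤ exp k}`. -/
noncomputable def conductorExp (ψ : AddChar K M)
    (v : Valuation K (WithZero (Multiplicative ℤ))) : ℤ :=
  sSup {k : ℤ | ∀ x : K, v x ≤ exp k → ψ x = 1}

variable (ψ : AddChar K M) (v : Valuation K (WithZero (Multiplicative ℤ)))

/-- «`ψ` trivial on `P^{-k}`» in terms of Mathlib's ball subgroup `v.leAddSubgroup (exp k)`. -/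
theorem forall_le_exp_iff (k : ℤ) :
    (∀ x : K, v x ≤ exp k → ψ x = 1) ↔ ∀ x ∈ v.leAddSubgroup (exp k), ψ x = 1 := by
  simp only [Valuation.mem_leAddSubgroup_iff]

/-- The balls are nested: trivial on `P^{-k'}` and `k ≤ k'` ⇒ trivial on `P^{-k}`. -/
theorem forall_le_exp_of_le {k k' : ℤ} (hk : k ≤ k') (h : ∀ x : K, v x ≤ exp k' → ψ x = 1) :
    ∀ x : K, v x ≤ exp k → ψ x = 1 :=
  fun x hx => h x (hx.trans (exp_le_exp.mpr hk))

/-- A point where `ψ ≠ 1` has valuation `exp m` for some integer `m`. -/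
theorem exists_val_eq_exp_of_ne_one {x : K} (hx : ψ x ≠ 1) : ∃ m : ℤ, v x = exp m := by
  have hx0 : x ≠ 0 := by
    rintro rfl
    exact hx (AddChar.map_zero_eq_one ψ)
  exact ⟨(v x).log, (exp_log ((Valuation.ne_zero_iff v).mpr hx0)).symm⟩

/-- If `ψ` is non-trivial, the set of `k` with `ψ` trivial on `P^{-k}` is bounded above. -/
theorem bddAbove_of_exists_ne_one (hψ : ∃ x : K, ψ x ≠ 1) :
    BddAbove {k : ℤ | ∀ x : K, v x ≤ exp k → ψ x = 1} := by
  obtain ⟨x, hx⟩ := hψ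
  obtain ⟨m, hm⟩ := exists_val_eq_exp_of_ne_one ψ v hx
  refine ⟨m, fun k hk => not_lt.mp fun hlt => ?_⟩
  exact hx (hk x (hm ▸ exp_le_exp.mpr hlt.le))

/-- If `ψ` is trivial on some ball and non-trivial somewhere, it is trivial on
`P^{-conductorExp ψ v}`: the supremum is attained. -/
theorem forall_le_exp_conductorExp (h₀ : ∃ k : ℤ, ∀ x : K, v x ≤ exp k → ψ x = 1)
    (hψ : ∃ x : K, ψ x ≠ 1) : ∀ x : K, v x ≤ exp (conductorExp ψ v) → ψ x = 1 :=
  Int.csSup_mem h₀ (bddAbove_of_exists_ne_one ψ v hψ)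

/-- «`ψ` trivial on `P^{-k}` ⟺ `k ≤ n(ψ)`» — the defining property of the conductor exponent. -/
theorem forall_le_exp_iff_le_conductorExp (h₀ : ∃ k : ℤ, ∀ x : K, v x ≤ exp k → ψ x = 1)
    (hψ : ∃ x : K, ψ x ≠ 1) (k : ℤ) :
    (∀ x : K, v x ≤ exp k → ψ x = 1) ↔ k ≤ conductorExp ψ v :=
  ⟨fun h => le_csSup (bddAbove_of_exists_ne_one ψ v hψ) h,
    fun h => forall_le_exp_of_le ψ v h (forall_le_exp_conductorExp ψ v h₀ hψ)⟩

/-- `ψ` is NOT trivial on `P^{-(n(ψ)+1)}`: there is `x` with `v x ≤ exp (n(ψ) + 1)` and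
`ψ x ≠ 1`. -/
theorem exists_le_exp_succ_ne_one (h₀ : ∃ k : ℤ, ∀ x : K, v x ≤ exp k → ψ x = 1)
    (hψ : ∃ x : K, ψ x ≠ 1) :
    ∃ x : K, v x ≤ exp (conductorExp ψ v + 1) ∧ ψ x ≠ 1 := by
  have h : ¬ ∀ x : K, v x ≤ exp (conductorExp ψ v + 1) → ψ x = 1 := by
    rw [forall_le_exp_iff_le_conductorExp ψ v h₀ hψ]
    omega
  simp only [not_forall, exists_prop] at h
  exact h

/-- The conductor exponent is characterised by «trivial on `P^{-n}`, not on `P^{-(n+1)}`». -/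
theorem conductorExp_eq_of (n : ℤ) (hn : ∀ x : K, v x ≤ exp n → ψ x = 1)
    (hn' : ¬ ∀ x : K, v x ≤ exp (n + 1) → ψ x = 1) (hψ : ∃ x : K, ψ x ≠ 1) :
    conductorExp ψ v = n := by
  have h₀ : ∃ k : ℤ, ∀ x : K, v x ≤ exp k → ψ x = 1 := ⟨n, hn⟩
  have h1 : n ≤ conductorExp ψ v := (forall_le_exp_iff_le_conductorExp ψ v h₀ hψ n).mp hn
  have h2 : ¬ n + 1 ≤ conductorExp ψ v := fun h =>
    hn' ((forall_le_exp_iff_le_conductorExp ψ v h₀ hψ (n + 1)).mpr h)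
  omega

/-! ### The balls `P^{-k}` are ordered by `k` when `v` takes the value `exp (-1)` -/

/-- With a uniformiser (`v ϖ = exp (-1)`), `P^{-k} ⊆ P^{-k'}` iff `k ≤ k'`. -/
theorem leAddSubgroup_exp_le_iff {ϖ : K} (hϖ : v ϖ = exp (-1 : ℤ)) (k k' : ℤ) :
    v.leAddSubgroup (exp k) ≤ v.leAddSubgroup (exp k') ↔ k ≤ k' := by
  have hval : v (ϖ ^ (-k)) = exp k := by
    rw [map_zpow₀, hϖ, ← exp_zsmul]
    congr 1
    simp
  constructor
  · intro h
    have hmem : ϖ ^ (-k) ∈ v.leAddSubgroup (exp k) := by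
      rw [Valuation.mem_leAddSubgroup_iff, hval]
    have := h hmem
    rw [Valuation.mem_leAddSubgroup_iff, hval, exp_le_exp] at this
    exact this
  · intro h x hx
    rw [Valuation.mem_leAddSubgroup_iff] at hx ⊢
    exact hx.trans (exp_le_exp.mpr h)

/-- «`ψ_F` trivial on `P_F^{-k}` ⟺ `P_F^{-k} ⊆ P_F^{-n(ψ_F)}`» — the dictionary in the form the
(A6) prose uses, for the fractional ideals `J = P^{-k}`. -/
theorem forall_le_exp_iff_leAddSubgroup_le (h₀ : ∃ k : ℤ, ∀ x : K, v x ≤ exp k → ψ x = 1)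
    (hψ : ∃ x : K, ψ x ≠ 1) {ϖ : K} (hϖ : v ϖ = exp (-1 : ℤ)) (k : ℤ) :
    (∀ x : K, v x ≤ exp k → ψ x = 1) ↔
      v.leAddSubgroup (exp k) ≤ v.leAddSubgroup (exp (conductorExp ψ v)) := by
  rw [forall_le_exp_iff_le_conductorExp ψ v h₀ hψ, leAddSubgroup_exp_le_iff v hϖ]

/-- Translation: `ψ (t ·)` is trivial on `P^{-k}` iff `ψ` is trivial on `P^{-(k - j)}`, where
`v t = exp (-j)`; hence `n (ψ (t ·)) = n (ψ) + j`. -/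
theorem forall_le_exp_compAddMonoidHom_mulLeft_iff (t : K) (ht : t ≠ 0) (j : ℤ)
    (hj : v t = exp (-j)) (k : ℤ) :
    (∀ x : K, v x ≤ exp k → (ψ.compAddMonoidHom (AddMonoidHom.mulLeft t)) x = 1) ↔
      ∀ x : K, v x ≤ exp (k - j) → ψ x = 1 := by
  constructor
  · intro h y hy
    have hx : v (t⁻¹ * y) ≤ exp k := by
      rw [Valuation.map_mul, Valuation.map_inv, hj, exp_neg, inv_inv]
      calc exp j * v y ≤ exp j * exp (k - j) := mul_le_mul_right hy _
        _ = exp k := by rw [← exp_add]; congr 1; ring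
    have := h (t⁻¹ * y) hx
    simpa [AddChar.compAddMonoidHom_apply, AddMonoidHom.coe_mulLeft, ← mul_assoc,
      mul_inv_cancel₀ ht] using this
  · intro h x hx
    simp only [AddChar.compAddMonoidHom_apply, AddMonoidHom.coe_mulLeft]
    apply h
    rw [Valuation.map_mul, hj]
    calc exp (-j) * v x ≤ exp (-j) * exp k := mul_le_mul_right hx _
      _ = exp (k - j) := by rw [← exp_add]; congr 1; ring

/-- `n (ψ (t ·)) = n (ψ) + j` for `v t = exp (-j)`. -/
theorem conductorExp_compAddMonoidHom_mulLeft (h₀ : ∃ k : ℤ, ∀ x : K, v x ≤ exp k → ψ x = 1)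
    (hψ : ∃ x : K, ψ x ≠ 1) (t : K) (ht : t ≠ 0) (j : ℤ) (hj : v t = exp (-j)) :
    conductorExp (ψ.compAddMonoidHom (AddMonoidHom.mulLeft t)) v = conductorExp ψ v + j := by
  obtain ⟨x, hx⟩ := hψ
  apply conductorExp_eq_of
  · rw [forall_le_exp_compAddMonoidHom_mulLeft_iff ψ v t ht j hj, add_sub_cancel_right]
    exact forall_le_exp_conductorExp ψ v h₀ ⟨x, hx⟩
  · rw [forall_le_exp_compAddMonoidHom_mulLeft_iff ψ v t ht j hj,
      forall_le_exp_iff_le_conductorExp ψ v h₀ ⟨x, hx⟩]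
    omega
  · refine ⟨t⁻¹ * x, ?_⟩
    simpa [AddChar.compAddMonoidHom_apply, AddMonoidHom.coe_mulLeft, ← mul_assoc,
      mul_inv_cancel₀ ht] using hx

end Summit.Ventures.HodgeRepro2.T5AdditiveConductor
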